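import Summits.Ventures.WeilGRH.UniformConductorFloorOneIff
import Summits.Ventures.WeilGRH.UniformConductorFloorPrincipalLog8
import Summits.Ventures.WeilGRH.UniformConductorFloorLog9Complete
import Summits.Ventures.WeilGRH.UniformConductorFloorLog10Primes
import Summits.Ventures.WeilGRH.UniformConductorFloorLog11Primes
import Summits.Ventures.WeilGRH.UniformConductorFloorLog12PrimesFinal
import HarnessLib

/-!
# GRH arm (rh-explicit, venture WeilGRH): THE PRIME-THRESHOLD LADDER OF RECORD — six windows, six exact thresholds, in one statement

Cell `rh-explicit`, WEIL TRACK — GRH ARM (weil-grh-1 gen11).  For a PRIME modulus `p` let `U_t(p)` say that every Dirichlet character mod `p`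
is Weil-positive on `[-t, t]` (`WeilPositivityOnChar χ t`, the tree's twisted explicit-formula functional; for the principal character this
is the no-polar-term convention, and by `UniformFloor.WeilPositivityOnChar.of_principal` the principal character decides `U_t(p)`).
The six certified rungs of the principal dichotomy (gen8 … gen11; flat windows, Galerkin witnesses, uniform joint-cell floors and door cells,
all kernel-checked) give the EXACT prime threshold `p*(t)` at six windows:

| `t`          | `e^{2t}` | `p*(t)` | last failing prime, how refuted          | source file                                   |
|--------------|----------|---------|------------------------------------------|-----------------------------------------------|
| `1`          | `7.39`   | `79`    | `73`, flat window                        | `UniformConductorFloorOneIff.lean`            |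
| `(log 8)/2`  | `8`      | `97`    | `89`, flat window                        | `UniformConductorFloorPrincipalLog8.lean`     |
| `log 3`      | `9`      | `127`   | `113`, flat window                       | `UniformConductorFloorLog9Complete.lean`      |
| `(log 10)/2` | `10`     | `173`   | `167`, table-based 32-mode Galerkin      | `UniformConductorFloorLog10Primes.lean`       |
| `(log 11)/2` | `11`     | `223`   | `211`, table-free 16-mode Galerkin       | `UniformConductorFloorLog11Primes.lean`       |
| `(log 12)/2` | `12`     | `281`   | `277`, table-based 40-mode Galerkin      | `UniformConductorFloorLog12PrimesFinal.lean`  |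

(least squares `ln p* = −0.89 + 5.25 t`, max residual `0.03`; informative only).  This file restates nothing: it packages the six `iff`
theorems as ONE conjunction (the ladder of record) and derives the SANDWICH corollaries — for the primes strictly between two consecutive
thresholds the supremum of the certified symmetric window lies between the two rungs (positivity at the lower window, a failing character at
the upper one).  RH/GRH-free bookkeeping of tree theorems; standard axioms; no definitions; no named facts; no kernel computation.

## References

* A. Weil (1952), (11) pp. 261–262 and the «lemme» p. 262 [Weil1952FormulesExplicites]; H. Yoshida (1992) §§5–7 [Yoshida1992HermitianForms].
-/

noncomputable section

namespace Summit.Ventures.WeilGRH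

open Literature.NumberTheory.LFunctions

namespace UniformFloor

variable {q : ℕ}

/-- ★★★ **THE PRIME-THRESHOLD LADDER**: for a prime `p`, the all-characters Weil-positivity statement on `[-t, t]` holds
iff `p ≥ 79 / 97 / 127 / 173 / 223 / 281` at `t = 1 / (log 8)/2 / log 3 / (log 10)/2 / (log 11)/2 / (log 12)/2` respectively.
[cite: Weil1952FormulesExplicites, (11) pp. 261–262 and the «lemme» p. 262] -/
theorem forall_weilPositivityOnChar_iff_of_prime_ladder (hp : q.Prime) :
    ((∀ χ : DirichletCharacter ℂ q, WeilPositivityOnChar χ 1) ↔ 79 ≤ q) ∧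
    ((∀ χ : DirichletCharacter ℂ q, WeilPositivityOnChar χ (Real.log 8 / 2)) ↔ 97 ≤ q) ∧
    ((∀ χ : DirichletCharacter ℂ q, WeilPositivityOnChar χ (Real.log 3)) ↔ 127 ≤ q) ∧
    ((∀ χ : DirichletCharacter ℂ q, WeilPositivityOnChar χ (Real.log 10 / 2)) ↔ 173 ≤ q) ∧
    ((∀ χ : DirichletCharacter ℂ q, WeilPositivityOnChar χ (Real.log 11 / 2)) ↔ 223 ≤ q) ∧
    ((∀ χ : DirichletCharacter ℂ q, WeilPositivityOnChar χ (Real.log 12 / 2)) ↔ 281 ≤ q) :=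
  ⟨forall_weilPositivityOnChar_one_iff_of_prime hp, forall_weilPositivityOnChar_log8half_iff_of_prime hp,
    forall_weilPositivityOnChar_log_three_iff_of_prime_complete hp, forall_weilPositivityOnChar_log10half_iff_of_prime_complete hp,
    forall_weilPositivityOnChar_log11half_iff_of_prime_complete hp, forall_weilPositivityOnChar_log12half_iff_of_prime_complete hp⟩

/-- SANDWICH 1→2: for a prime `79 ≤ p ≤ 89` every character is Weil-positive on `[-1, 1]` and some character fails on
`[-(log 8)/2, (log 8)/2]`. [cite: Weil1952FormulesExplicites, (11) pp. 261–262] -/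
theorem ladder_sandwich_one_log8half (hp : q.Prime) (h₁ : 79 ≤ q) (h₂ : q ≤ 89) :
    (∀ χ : DirichletCharacter ℂ q, WeilPositivityOnChar χ 1) ∧
      ∃ χ : DirichletCharacter ℂ q, ¬ WeilPositivityOnChar χ (Real.log 8 / 2) := by
  obtain ⟨h1, h8, -⟩ := forall_weilPositivityOnChar_iff_of_prime_ladder hp
  refine ⟨h1.2 h₁, ?_⟩
  by_contra h
  push Not at h
  have := h8.1 h
  omega

/-- SANDWICH 2→3: for a prime `97 ≤ p ≤ 113` every character is Weil-positive on `[-(log 8)/2, (log 8)/2]` and some character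
fails on `[-log 3, log 3]`. [cite: Weil1952FormulesExplicites, (11) pp. 261–262] -/
theorem ladder_sandwich_log8half_log_three (hp : q.Prime) (h₁ : 97 ≤ q) (h₂ : q ≤ 113) :
    (∀ χ : DirichletCharacter ℂ q, WeilPositivityOnChar χ (Real.log 8 / 2)) ∧
      ∃ χ : DirichletCharacter ℂ q, ¬ WeilPositivityOnChar χ (Real.log 3) := by
  obtain ⟨-, h8, h9, -⟩ := forall_weilPositivityOnChar_iff_of_prime_ladder hp
  refine ⟨h8.2 h₁, ?_⟩
  by_contra h
  push Not at h
  have := h9.1 h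
  omega

/-- SANDWICH 3→4: for a prime `127 ≤ p ≤ 167` every character is Weil-positive on `[-log 3, log 3]` and some character fails on
`[-(log 10)/2, (log 10)/2]`. [cite: Weil1952FormulesExplicites, (11) pp. 261–262] -/
theorem ladder_sandwich_log_three_log10half (hp : q.Prime) (h₁ : 127 ≤ q) (h₂ : q ≤ 167) :
    (∀ χ : DirichletCharacter ℂ q, WeilPositivityOnChar χ (Real.log 3)) ∧
      ∃ χ : DirichletCharacter ℂ q, ¬ WeilPositivityOnChar χ (Real.log 10 / 2) := by
  obtain ⟨-, -, h9, h10, -⟩ := forall_weilPositivityOnChar_iff_of_prime_ladder hp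
  refine ⟨h9.2 h₁, ?_⟩
  by_contra h
  push Not at h
  have := h10.1 h
  omega

/-- SANDWICH 4→5: for a prime `173 ≤ p ≤ 211` every character is Weil-positive on `[-(log 10)/2, (log 10)/2]` and some character
fails on `[-(log 11)/2, (log 11)/2]`. [cite: Weil1952FormulesExplicites, (11) pp. 261–262] -/
theorem ladder_sandwich_log10half_log11half (hp : q.Prime) (h₁ : 173 ≤ q) (h₂ : q ≤ 211) :
    (∀ χ : DirichletCharacter ℂ q, WeilPositivityOnChar χ (Real.log 10 / 2)) ∧
      ∃ χ : DirichletCharacter ℂ q, ¬ WeilPositivityOnChar χ (Real.log 11 / 2) := by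
  obtain ⟨-, -, -, h10, h11, -⟩ := forall_weilPositivityOnChar_iff_of_prime_ladder hp
  refine ⟨h10.2 h₁, ?_⟩
  by_contra h
  push Not at h
  have := h11.1 h
  omega

/-- SANDWICH 5→6: for a prime `223 ≤ p ≤ 277` every character is Weil-positive on `[-(log 11)/2, (log 11)/2]` and some character
fails on `[-(log 12)/2, (log 12)/2]`. [cite: Weil1952FormulesExplicites, (11) pp. 261–262] -/
theorem ladder_sandwich_log11half_log12half (hp : q.Prime) (h₁ : 223 ≤ q) (h₂ : q ≤ 277) :
    (∀ χ : DirichletCharacter ℂ q, WeilPositivityOnChar χ (Real.log 11 / 2)) ∧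
      ∃ χ : DirichletCharacter ℂ q, ¬ WeilPositivityOnChar χ (Real.log 12 / 2) := by
  obtain ⟨-, -, -, -, h11, h12⟩ := forall_weilPositivityOnChar_iff_of_prime_ladder hp
  refine ⟨h11.2 h₁, ?_⟩
  by_contra h
  push Not at h
  have := h12.1 h
  omega

/-- MONOTONE LADDER: the six thresholds are attained in increasing order — a prime that passes at a rung passes at every LOWER rung
(stated for the top rung: `p ≥ 281` passes all six windows). [cite: Weil1952FormulesExplicites, (11) pp. 261–262] -/
theorem forall_weilPositivityOnChar_all_rungs_of_prime_ge_281 (hp : q.Prime) (h : 281 ≤ q) (χ : DirichletCharacter ℂ q) :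
    WeilPositivityOnChar χ 1 ∧ WeilPositivityOnChar χ (Real.log 8 / 2) ∧ WeilPositivityOnChar χ (Real.log 3) ∧
      WeilPositivityOnChar χ (Real.log 10 / 2) ∧ WeilPositivityOnChar χ (Real.log 11 / 2) ∧ WeilPositivityOnChar χ (Real.log 12 / 2) := by
  obtain ⟨h1, h8, h9, h10, h11, h12⟩ := forall_weilPositivityOnChar_iff_of_prime_ladder hp
  exact ⟨h1.2 (by omega) χ, h8.2 (by omega) χ, h9.2 (by omega) χ, h10.2 (by omega) χ, h11.2 (by omega) χ, h12.2 h χ⟩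

end UniformFloor

end Summit.Ventures.WeilGRH

end
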